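import Summits.QuantumFields.BalabanUV.T4Continuum.Support.NE9CurChartUniformBall
import Literature.MathematicalPhysics.QuantumFieldTheory.Balaban1983to89.B12Eq422KernelCauchy

/-!
# NE9KerChartCauchyCore — THE DECAY-FREE CAUCHY CORE OF THE KERNEL SPECIES `ker U` AT THE `cur U` CHART, AT A FIXED LATTICE: for every
# unit-bounded small-bond background `U`, every (L3) slot and EVERY old term `F` holomorphic and bounded by `M` on the chart's target ball, the
# block-field derivatives of the composite `F ∘ chart_U` at `B = 0` obey `‖Dⁿ(F ∘ chart_U)(0)‖ ≤ M·(n∕ρ)ⁿ` (`ρ < R_b`); cell `pub-balaban`, T4-DAG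
# §2 node U3 / §6 NE9, WALL-NE9-P1 §3 (ii)∕(vii) (MODEL item O-NE9-1 (ii) «the kernel species `ker`», owner plan `KER-SPECIES-PLAN.md` K1∕K2);
# BINDER row NE9 OWNER lineage `b2b-balaban-t4-ne9-p1`, generation 82; Summits-side NEW leaf under the owner's INTERFACE REQUEST NE9 #2 of this
# generation (ruling e34b3e0c (0); requested interface: `NE9KerChartCauchyCore.oldTerm_comp_cur_chart_iteratedFDeriv_le`; consumer: the END
# `Support/NE9Lemma1KernelSpecies` (K) `kerBound` through `B12Eq419Kernel.kernelE`; a separate file because the host leaf `NE9CurChartUniformBall`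
# is at 345 lines), nothing printed asserted

HONEST FRAMING (T4-DAG PAGE 1).  Rung (B)+1 of the FINITE-VOLUME T⁴ programme — NOT infinite volume, NOT a mass gap, NOT the Clay problem.  NE9
(`T4OutputRate.NE9` ∧ `FadingMemory`) is a cell NEW ESTIMATE, NOT PRINTED in [I] = [Balaban1987RG1] (CMP **109**), [II] = [Balaban1988RG2Cluster]
(CMP **116**), and NOT PROVED here («NE9 ⇐ the named binders»; spine PROVED 0∕9).  HONEST DEPENDENCY (cell line, verbatim): continuum YM on T⁴ ⇐
BetaPertH ∧ nine spine estimates (0/9 proved); BetaPertH ⇐ (D1) ∧ (D4) ∧ CAP+tail; G-an2-4 gates asym, D1 and NE2/3/4.  The `ker U` OBJECT is ONE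
item of the MODEL O-NE9-1 (species (b) data); the END's `act` half and NEEDS-COORDINATOR #5 are untouched; this file does NOT construct `ker`.

WHAT THIS FILE PROVES (TWO theorems + one norm identity; 0 def, 0 sorry, axioms standard).  **`oldTerm_comp_cur_chart_iteratedFDeriv_le`**: with the letters and
radii of `NE9CurChartUniformBall.cur_chart_exists_of_small_bonds` (∃ ε₃ ≤ ε_reg(d, L) ∀ (C₄, a₃) ∃ ε₄ ε_C R_b R′ ∀ U with `U(b) ∈ U1`,
`‖U(b) − 1‖ ≤ ε ≤ ε₃`, `hRS`, ∀ (L3) slot `W` quadratic-analytic): the positivity `hpos` holds and FOR EVERY old term `F : Space115(∇_U) → X`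
(`X` complete) holomorphic on `ball 0 R′` with `‖F‖ ≤ M` there, every `0 < ρ < R_b` and every `n`,
`‖iteratedFDeriv ℂ n (F ∘ chart_U) 0‖ ≤ M·(n∕ρ)ⁿ`, `chart_U = chartHB 𝔊(U) 0 W 0 (A′ ↦ A′ + solA H₁(U) 0 C(U) 0 ε_C A′) ε₄ H₁(U)` — print's
(4.2)–(4.5): «Differentiating the composite function … n times with respect to B» with the analyticity factor of the constant `B₃` made a
KERNEL number; **`sum_norm_kernelE_oldTerm_comp_cur_chart_le`**: the kernels `𝐄⁽ⁿ⁾(x₁,…,x_n)` of (4.19)∕(4.21) of `F ∘ chart_U`, read on the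
sup-normed `Bond → 𝔸` through the weight-`1` identification of the block-field carrier `NegSize(L, η, lev_B, 0)` (`norm_symm_eq_of_weight_one`),
obey `Σ_{xs} ‖𝐄⁽ⁿ⁾(xs)[v₁(xs₁),…,v_n(xs_n)]‖ ≤ M·(n∕ρ)ⁿ·∏_k |v_k|₁` — (4.22)'s shape WITHOUT the decay weights.
MECHANISM: `B12Eq422KernelCauchy.norm_iteratedFDeriv_comp_le_of_ball` (Cauchy inequalities for a bounded holomorphic composite, Chae 1985 13.6 in
`Literature.Analysis.Complex.HolomorphicBanach`) at (Ψ1) `DifferentiableOn` + (Ψ2) `MapsTo ball 0 R_b → ball 0 R′` of the host theorem.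
DISGUISE TEST: composition of landed theorems; the bound is the Cauchy constant at a FIXED lattice — NOT the decay factor
`exp(−δ₀(dist(X, x) + dist(X, x₃)))` of (4.5)∕(4.22) ([Balaban1985Variational] (189)–(190), the lattice-uniformity T-row), NOT the field sizes
(4.17)–(4.18), NOT the END's (K) `kerBound` (which carries the decay), NOT a definition of `ker`; not NE9.
References (TYPES ∕ loci only): [Balaban1987RG1] (4.2)–(4.5) p. 281–282, (4.19)–(4.22) p. 285–286; [Balaban1985Variational] (172)–(175) p. 305.
Imports `Support/NE9CurChartUniformBall` (v1.2), `B12Eq422KernelCauchy`; modifies nothing; no END re-wired.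
Value = WALL-NE9-P1 §3 (vii) «of (ii) remain `ker` …»: the analyticity half of `kerBound` at the constructed chart is now a KERNEL statement for
every admissible old term; NOT summit progress.
-/

noncomputable section

open Metric Set Finset
open scoped BigOperators

namespace Summit.QuantumFields.BalabanUV.T4Continuum.NE9KerChartCauchyCore

open Literature.MathematicalPhysics.QuantumFieldTheory.Balaban1983to89
open B11Eq103H1Complex B11Eq115Space B11Eq174Chart B11Eq111FrakG
open B13Contraction113 (QuadAnalytic)
open B9Eq319QprimeTorus (fineP)
open B9SectCLatticeCarrier (Bond)
open B7Prop1Explicit (U1)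
open B9Eq315QTorus (laplaceAofBackground)
open B9Eq315QTorusOnto (QtorusW_surjective)
open B9Eq310HessianOperator (adTransportW)
open B11Eq44COperatorTorus (Cc)
open B9Eq335SmallBondsData (perCfg_mem_U1 hreg_of_small_bonds alpha_le_64 alphaL_le_half)
open B12Eq422KernelCauchy (norm_iteratedFDeriv_comp_le_of_ball sum_norm_kernelE_comp_apply_le)
open B12Eq419Kernel (kernelE)
open Summit.QuantumFields.BalabanUV.T4Continuum.NE9CurChartUniformBall (cur_chart_exists_of_small_bonds)

/-- **THE DECAY-FREE CAUCHY CORE OF THE KERNEL SPECIES AT THE `cur U` CHART** — see the module header: for every unit-bounded small-bond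
background, every quadratic-analytic (L3) slot and every old term `F` holomorphic and bounded by `M` on the chart's target ball,
`‖Dⁿ(F ∘ chart_U)(0)‖ ≤ M·(n∕ρ)ⁿ` for `0 < ρ < R_b`; all letters and radii those of `cur_chart_exists_of_small_bonds`. [folklore] -/
theorem oldTerm_comp_cur_chart_iteratedFDeriv_le {d : ℕ} (L : ℕ) [NeZero L] (m : Fin d → ℕ) [∀ i, NeZero (fineP L m i)] (hL : 1 ≤ L)
    {𝔸 : Type*} [NormedRing 𝔸] [NormedAlgebra ℂ 𝔸] [CompleteSpace 𝔸] [NormOneClass 𝔸] [StarRing 𝔸] [NormedStarGroup 𝔸] [StarModule ℂ 𝔸]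
    [FiniteDimensional ℂ 𝔸]
    {W : Type*} [NormedAddCommGroup W] [InnerProductSpace ℂ W] [FiniteDimensional ℂ W] (φ : W ≃ₗ[ℂ] 𝔸) {Mφ Mφ' : ℝ} (hMφ : 0 ≤ Mφ)
    (hMφ' : 0 ≤ Mφ') (hφ : ∀ w, ‖φ w‖ ≤ Mφ * ‖w‖) (hφ' : ∀ X, ‖φ.symm X‖ ≤ Mφ' * ‖X‖)
    (τ : 𝔸 →ₗ[ℂ] ℂ) {Cτ : ℝ} (hτ : ∀ X, ‖τ X‖ ≤ Cτ * ‖X‖) (hCτ : 0 ≤ Cτ)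
    {η : ℝ} [Fact (0 < (L : ℝ))] [Fact (0 < η)] {lev₀ : Bond d (fineP L m) → ℕ} {levB : Bond d m → ℕ} (lev₁ : Bond d (fineP L m) × Fin d → ℕ)
    (hlev : ∀ b, 1 ≤ lev₀ b) {c₀ c₁ : ℝ} [Fact (0 < c₀)] [Fact (0 < c₁)] {a : ℝ} (ha : 0 < a)
    {X : Type*} [NormedAddCommGroup X] [NormedSpace ℂ X] [CompleteSpace X] :
    ∃ ε₃ : ℝ, 0 < ε₃ ∧ ε₃ ≤ 1 / (256 * ((d : ℝ) + 1) ^ 2 * (L : ℝ) ^ (d + 1)) ∧ ∀ {C₄ a₃ : ℝ}, 0 ≤ C₄ → 0 < a₃ →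
      ∃ ε₄ εC Rb R' : ℝ, 0 < Rb ∧ 0 < R' ∧ ∀ (U : Bond d (fineP L m) → 𝔸ˣ) (hU : ∀ b, U b ∈ U1 𝔸) {ε : ℝ} (hε : 0 ≤ ε)
      (hεr : ε ≤ 1 / (256 * ((d : ℝ) + 1) ^ 2 * (L : ℝ) ^ (d + 1))), ε ≤ ε₃ → ∀ (hUε : ∀ b, ‖(U b : 𝔸) - 1‖ ≤ ε),
      (∀ (b : Bond d (fineP L m)) (v u : W), inner ℂ (adTransportW φ U b v) u = inner ℂ v (adTransportW φ (fun b => (U b)⁻¹) b u)) →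
      ∀ {Wq : Space115 (L : ℝ) η lev₀ lev₁ (nabla115 η U) → NegSize (L : ℝ) η lev₀ 3 𝔸}, QuadAnalytic Wq C₄ a₃ →
        AnalyticOnNhd ℂ Wq {Y | ‖Y‖ < a₃} →
      ∃ hpos : ∀ x : BondL2K ℂ d (fineP L m) c₀ W, x ≠ 0 →
          0 < RCLike.re (inner ℂ x (laplaceAofBackground L m hL φ U (alpha_le_64 hL hε hεr) (perCfg_mem_U1 L m hU)
            (hreg_of_small_bonds L m hU hε hUε) τ η (c₀ := c₀) (c₁ := c₁) a x)),
        ∀ {F : Space115 (L : ℝ) η lev₀ lev₁ (nabla115 η U) → X} {M ρ : ℝ}, DifferentiableOn ℂ F (ball 0 R') →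
          (∀ y ∈ ball (0 : Space115 (L : ℝ) η lev₀ lev₁ (nabla115 η U)) R', ‖F y‖ ≤ M) → 0 < ρ → ρ < Rb → ∀ n : ℕ,
          ‖iteratedFDeriv ℂ n (F ∘ (chartHB (frakGLatticeCLM (lev₀ := lev₀) φ hpos (QtorusW_surjective L m hL U (alpha_le_64 hL hε hεr) (perCfg_mem_U1 L m hU)
              (hreg_of_small_bonds L m hU hε hUε) (alphaL_le_half hL hεr) φ) lev₁ (nabla115 η U))
            0 Wq 0 (fun A' => A' + solA (H1LatticeCLM (lev₀ := lev₀) (levB := levB) φ hpos (QtorusW_surjective L m hL U (alpha_le_64 hL hε hεr)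
              (perCfg_mem_U1 L m hU) (hreg_of_small_bonds L m hU hε hUε) (alphaL_le_half hL hεr) φ) lev₁ (nabla115 η U))
              0 (Cc L m η U lev₀ lev₁ (nabla115 η U) levB) 0 εC A') ε₄
            (H1LatticeCLM (lev₀ := lev₀) (levB := levB) φ hpos (QtorusW_surjective L m hL U (alpha_le_64 hL hε hεr) (perCfg_mem_U1 L m hU)
              (hreg_of_small_bonds L m hU hε hUε) (alphaL_le_half hL hεr) φ) lev₁ (nabla115 η U)))) 0‖ ≤ M * ((n : ℝ) / ρ) ^ n := by
  obtain ⟨ε₃, hε₃, hle, H⟩ := cur_chart_exists_of_small_bonds L m hL φ hMφ hMφ' hφ hφ' τ hτ hCτ (η := η) (levB := levB) lev₁ hlev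
    (c₀ := c₀) (c₁ := c₁) ha
  refine ⟨ε₃, hε₃, hle, fun {C₄ a₃} hC₄ ha₃ => ?_⟩
  obtain ⟨ε₄, εC, Rb, R', hRb0, hR'0, H'⟩ := H hC₄ ha₃
  refine ⟨ε₄, εC, Rb, R', hRb0, hR'0, ?_⟩
  intro U hU ε hε hεr hεm hUε hRS Wq hW hWa
  obtain ⟨hpos, hdiff, hmaps, -⟩ := H' U hU hε hεr hεm hUε hRS hW hWa
  exact ⟨hpos, fun {F M ρ} hF hM hρ hρR n => norm_iteratedFDeriv_comp_le_of_ball hdiff hmaps hF hM hρ hρR n⟩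

/-- A weighted sup space with weight identically `1` IS the sup-normed `ι → V` along the identification `NegSup.continuousLinearEquiv`
(used for the block-field carrier `NegSize(L, η, lev_B, 0)`, weight `(L^{lev}η)⁰ = 1`). [folklore] -/
theorem norm_symm_eq_of_weight_one {ι : Type*} [Fintype ι] {V : Type*} [NormedAddCommGroup V] [NormedSpace ℂ V]
    (w : ι → ℝ) [Fact (∀ i, 0 < w i)] (hw : ∀ i, w i = 1) (g : ι → V) :
    ‖(NegSup.continuousLinearEquiv ℂ (V := V) w).symm g‖ = ‖g‖ := by
  have e1 : ∀ b, NegSup.equiv w V ((NegSup.continuousLinearEquiv ℂ (V := V) w).symm g) b = g b := fun _ => rfl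
  apply le_antisymm
  · refine (NegSup.norm_le_iff (norm_nonneg g)).2 fun b => ?_
    rw [hw, one_mul, e1]
    exact norm_le_pi_norm g b
  · refine (pi_norm_le_iff_of_nonneg (norm_nonneg ((NegSup.continuousLinearEquiv ℂ (V := V) w).symm g))).2 fun b => ?_
    have h := NegSup.weight_mul_norm_apply_le ((NegSup.continuousLinearEquiv ℂ (V := V) w).symm g) b
    rwa [hw, one_mul, e1] at h

/-- **THE KERNELS `𝐄⁽ⁿ⁾(x₁,…,x_n)` OF THE OLD TERM ∘ `cur U` CHART, SUMMED AGAINST BLOCK FIELDS, DECAY-FREE** ((4.19)∕(4.21) at the constructed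
chart; `B12Eq422KernelCauchy.sum_norm_kernelE_comp_apply_le`): with the same letters, for every old term `F` holomorphic and bounded by `M` on
`ball 0 R′`, every `0 < ρ < R_b`, `n` and block fields `v₁,…,v_n : Bond → 𝔸`,
`Σ_{xs} ‖𝐄⁽ⁿ⁾(xs)[v₁(xs₁),…,v_n(xs_n)]‖ ≤ M·(n∕ρ)ⁿ·∏_k Σ_b ‖v_k(b)‖`, `𝐄 = F ∘ chart_U` read on `Bond → 𝔸` (weight-`1` identification). [folklore] -/
theorem sum_norm_kernelE_oldTerm_comp_cur_chart_le {d : ℕ} (L : ℕ) [NeZero L] (m : Fin d → ℕ) [∀ i, NeZero (fineP L m i)] (hL : 1 ≤ L)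
    {𝔸 : Type*} [NormedRing 𝔸] [NormedAlgebra ℂ 𝔸] [CompleteSpace 𝔸] [NormOneClass 𝔸] [StarRing 𝔸] [NormedStarGroup 𝔸] [StarModule ℂ 𝔸]
    [FiniteDimensional ℂ 𝔸]
    {W : Type*} [NormedAddCommGroup W] [InnerProductSpace ℂ W] [FiniteDimensional ℂ W] (φ : W ≃ₗ[ℂ] 𝔸) {Mφ Mφ' : ℝ} (hMφ : 0 ≤ Mφ)
    (hMφ' : 0 ≤ Mφ') (hφ : ∀ w, ‖φ w‖ ≤ Mφ * ‖w‖) (hφ' : ∀ X, ‖φ.symm X‖ ≤ Mφ' * ‖X‖)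
    (τ : 𝔸 →ₗ[ℂ] ℂ) {Cτ : ℝ} (hτ : ∀ X, ‖τ X‖ ≤ Cτ * ‖X‖) (hCτ : 0 ≤ Cτ)
    {η : ℝ} [Fact (0 < (L : ℝ))] [Fact (0 < η)] {lev₀ : Bond d (fineP L m) → ℕ} {levB : Bond d m → ℕ} (lev₁ : Bond d (fineP L m) × Fin d → ℕ)
    (hlev : ∀ b, 1 ≤ lev₀ b) {c₀ c₁ : ℝ} [Fact (0 < c₀)] [Fact (0 < c₁)] {a : ℝ} (ha : 0 < a)
    {X : Type*} [NormedAddCommGroup X] [NormedSpace ℂ X] [CompleteSpace X] :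
    ∃ ε₃ : ℝ, 0 < ε₃ ∧ ε₃ ≤ 1 / (256 * ((d : ℝ) + 1) ^ 2 * (L : ℝ) ^ (d + 1)) ∧ ∀ {C₄ a₃ : ℝ}, 0 ≤ C₄ → 0 < a₃ →
      ∃ ε₄ εC Rb R' : ℝ, 0 < Rb ∧ 0 < R' ∧ ∀ (U : Bond d (fineP L m) → 𝔸ˣ) (hU : ∀ b, U b ∈ U1 𝔸) {ε : ℝ} (hε : 0 ≤ ε)
      (hεr : ε ≤ 1 / (256 * ((d : ℝ) + 1) ^ 2 * (L : ℝ) ^ (d + 1))), ε ≤ ε₃ → ∀ (hUε : ∀ b, ‖(U b : 𝔸) - 1‖ ≤ ε),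
      (∀ (b : Bond d (fineP L m)) (v u : W), inner ℂ (adTransportW φ U b v) u = inner ℂ v (adTransportW φ (fun b => (U b)⁻¹) b u)) →
      ∀ {Wq : Space115 (L : ℝ) η lev₀ lev₁ (nabla115 η U) → NegSize (L : ℝ) η lev₀ 3 𝔸}, QuadAnalytic Wq C₄ a₃ →
        AnalyticOnNhd ℂ Wq {Y | ‖Y‖ < a₃} →
      ∃ hpos : ∀ x : BondL2K ℂ d (fineP L m) c₀ W, x ≠ 0 →
          0 < RCLike.re (inner ℂ x (laplaceAofBackground L m hL φ U (alpha_le_64 hL hε hεr) (perCfg_mem_U1 L m hU)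
            (hreg_of_small_bonds L m hU hε hUε) τ η (c₀ := c₀) (c₁ := c₁) a x)),
        ∀ {F : Space115 (L : ℝ) η lev₀ lev₁ (nabla115 η U) → X} {M ρ : ℝ}, DifferentiableOn ℂ F (ball 0 R') →
          (∀ y ∈ ball (0 : Space115 (L : ℝ) η lev₀ lev₁ (nabla115 η U)) R', ‖F y‖ ≤ M) → 0 < ρ → ρ < Rb → ∀ (n : ℕ) (v : Fin n → Bond d m → 𝔸),
          ∑ xs : Fin n → Bond d m, ‖kernelE (𝕜 := ℂ) n (F ∘ (chartHB (frakGLatticeCLM (lev₀ := lev₀) φ hpos (QtorusW_surjective L m hL U (alpha_le_64 hL hε hεr) (perCfg_mem_U1 L m hU)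
              (hreg_of_small_bonds L m hU hε hUε) (alphaL_le_half hL hεr) φ) lev₁ (nabla115 η U))
            0 Wq 0 (fun A' => A' + solA (H1LatticeCLM (lev₀ := lev₀) (levB := levB) φ hpos (QtorusW_surjective L m hL U (alpha_le_64 hL hε hεr)
              (perCfg_mem_U1 L m hU) (hreg_of_small_bonds L m hU hε hUε) (alphaL_le_half hL hεr) φ) lev₁ (nabla115 η U))
              0 (Cc L m η U lev₀ lev₁ (nabla115 η U) levB) 0 εC A') ε₄
            (H1LatticeCLM (lev₀ := lev₀) (levB := levB) φ hpos (QtorusW_surjective L m hL U (alpha_le_64 hL hε hεr) (perCfg_mem_U1 L m hU)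
              (hreg_of_small_bonds L m hU hε hUε) (alphaL_le_half hL hεr) φ) lev₁ (nabla115 η U)))
            ∘ ⇑(NegSup.continuousLinearEquiv ℂ (V := 𝔸) (levWeight (L : ℝ) η levB 0)).symm) 0 xs (fun k => v k (xs k))‖ ≤
            M * ((n : ℝ) / ρ) ^ n * ∏ k, ∑ b, ‖v k b‖ := by
  obtain ⟨ε₃, hε₃, hle, H⟩ := cur_chart_exists_of_small_bonds L m hL φ hMφ hMφ' hφ hφ' τ hτ hCτ (η := η) (levB := levB) lev₁ hlev
    (c₀ := c₀) (c₁ := c₁) ha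
  refine ⟨ε₃, hε₃, hle, fun {C₄ a₃} hC₄ ha₃ => ?_⟩
  obtain ⟨ε₄, εC, Rb, R', hRb0, hR'0, H'⟩ := H hC₄ ha₃
  refine ⟨ε₄, εC, Rb, R', hRb0, hR'0, ?_⟩
  intro U hU ε hε hεr hεm hUε hRS Wq hW hWa
  obtain ⟨hpos, hdiff, hmaps, -⟩ := H' U hU hε hεr hεm hUε hRS hW hWa
  refine ⟨hpos, fun {F M ρ} hF hM hρ hρR n v => ?_⟩
  -- the block-field carrier `NegSize(L, η, lev_B, 0)` (weight `(L^{lev}η)⁰ = 1`) IS the sup-normed `Bond → 𝔸`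
  have hE : MapsTo (⇑(NegSup.continuousLinearEquiv ℂ (V := 𝔸) (levWeight (L : ℝ) η levB 0)).symm)
      (ball (0 : Bond d m → 𝔸) Rb) (ball (0 : NegSize (L : ℝ) η levB 0 𝔸) Rb) := fun g hg => by
    rw [mem_ball_zero_iff] at hg ⊢
    rwa [norm_symm_eq_of_weight_one (levWeight (L : ℝ) η levB 0) (fun b => by simp [levWeight]) g]
  have hΦ := hdiff.comp (NegSup.continuousLinearEquiv ℂ (V := 𝔸) (levWeight (L : ℝ) η levB 0)).symm.differentiableOn hE
  exact sum_norm_kernelE_comp_apply_le hΦ (hmaps.comp hE) hF hM hρ hρR n v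

end Summit.QuantumFields.BalabanUV.T4Continuum.NE9KerChartCauchyCore

end
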